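import Literature.AnabelianGeometry.EtaleTheta.Discharge.Sec5Prop51AtWeakVocabularyData
import Literature.AnabelianGeometry.EtaleTheta.Discharge.Sec3Example39ivCuspidallyPureDotC
import Literature.AnabelianGeometry.SemiGraphs.TemperedDecompositionCompact

/-!
# [EtTh] Prop. 5.1 — the node closer at the TEXT's Example 3.9 (i) instance `X = Ċ` (arrows `Ẋ → Ċ`) over `B^temp(Π^tp_Ċ)⁰` (p. 323 / PDF p. 97)

S. Mochizuki, *The étale theta function and its Frobenioid-theoretic manifestations*, Publ. RIMS **45** (2009)
[cite: MochizukiEtTh2009, Prop 5.1 p.323 (PDF p.97); Ex 3.9 (i) p.309 (PDF p.83); Rmk 3.7.2 p.306 (PDF p.80)].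

PROOF-ONLY sequel (no `def`, no instance, no new named fact) of this seat's `Discharge/Sec5Prop51AtWeakVocabularyData.lean` (p488786; abc-iut cell,
layer L2, seat abc-iut-w6-d047 gen 4, abc-iut-L2-lead R946 census):
* **`ThetaCovers.TemperedCoverData.prop51_dotC_ofRankOneObject`** — the closer FIRES at the TEXT's own Example 3.9 (i) instance `X = Ċ` over
  `D_W = B^temp(Π^tp_Ċ)⁰` of the Def. 2.5 tempered tower (abc-iut-L2-t2 `TemperedCoverData`, abc-iut-w6-d059's induction-functor square), (iii) :=
  the rank-one engine, with F-0615 CLOSED there by `example39_iv_cuspidallyPure_dotC_ofRankOneObject` (p483876) and F-2363 GONE; hypotheses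
  «`Π^tp_C` tempered» (print's standing one; `Π^tp_Ċ` is then tempered as a closed subgroup, abc-iut-L3's `IsTempered.subgroup_of_isClosed`) and
  «`Π^tp_Ċ` temp-slim»; residual = {`𝔉`, `h𝔉`, `Ψ`, the three vocabulary pins}.
HONEST LABEL: rank one ⇒ Def. 3.6 (v)(b) one-sided at this datum; pins are free predicates (no [FrdI] Def. 4.5 vocabulary in the tree); nothing here
bears on [IUTchIII] Cor. 3.12; typed ≠ proved; no side taken. [claim: MochizukiEtTh2009, status: refereed pre-IUT]
-/

noncomputable section

namespace Literature.AnabelianGeometry.EtaleTheta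

open CategoryTheory Opposite Function Literature.AlgebraicGeometry.Frobenioids Literature.AlgebraicGeometry.Frobenioids.QuasiTemperoid
  Literature.AnabelianGeometry.SemiGraphs Literature.AlgebraicGeometry.Frobenioids.QuasiTemperoid.BTempConnected

universe u₀ v₀

namespace ThetaCovers.TemperedCoverData

open Example39BaseSquare

variable {l : ℕ} (T : TemperedCoverData.{0} l) (hT : IsTempered T.Gtp)
  {D₀ : Type u₀} [Category.{v₀} D₀] {dm : DivisorMonoids.{u₀, v₀, 0} D₀} (P₀ : dm.RankOneObject)
  (hpf : ∀ Y : D₀ᵒᵖ, IsPerfFactorialCof (dm.Φ₀.obj Y)) (R S : ((Discrete PUnit.{1})ᵒᵖ ⥤ CommMonCat.{0}) → Prop)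
  (R' S' : ((ConnectedPart (BTemp ↥T.PiCdot))ᵒᵖ ⥤ CommMonCat.{0}) → Prop)
  {A B : ConnectedPart (BTemp ↥T.PiCdot)} (α : A ⟶ B)
  (IsRationalα IsStrictlyRationalα : ((Example39Data.Dα α)ᵒᵖ ⥤ CommMonCat.{0}) → Prop)

/-- **EtTh:Prop5.1's closer at the TEXT's Example 3.9 (i) instance `X = Ċ` (arrows `Ẋ → Ċ`) over `B^temp(Π^tp_Ċ)⁰`, (iii) := the rank-one engine**
(F-0615 CLOSED there: `example39_iv_cuspidallyPure_dotC_ofRankOneObject`, p483876; F-2363 GONE; «slim» from `Π^tp_C` tempered + `Π^tp_Ċ` temp-slim);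
residual = {`𝔉`, `h𝔉`, `Ψ`, pins}. [cite: MochizukiEtTh2009, Prop 5.1 p.323 (PDF p.97); Ex 3.9 (i) p.309 (PDF p.83)] -/
theorem prop51_dotC_ofRankOneObject (hZs : IsSlimGroup ↥T.PiCdot)
    (𝔉 : ThetaFrobenioid.{0}
      ((Example39Data.ofInducedSquare T.dotXToDotC (MonoidHom.id _) (MonoidHom.id _) T.dotXToDotC
        (isOpenMap_dotXToDotC T) IsOpenMap.id IsOpenMap.id (isOpenMap_dotXToDotC T)
        (continuous_dotXToDotC T) continuous_id continuous_id (continuous_dotXToDotC T)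
        (countable_quotient_PiCdot T hT) (countable_quotient_dotX T hT) (countable_quotient_PiCdot T hT)
        (by rw [MonoidHom.id_comp, MonoidHom.comp_id]) treeMonoidVocabWeak.{0}
        ((RealifiedDivisorMonoids.ofRlfZWeak dm hpf).precomp
          (TemperedFrobenioid.ofRankOneObjectConnectedPart P₀ hpf R S ↥T.PiCdot R' S').base)
        ⊤ (ObjectProperty.topEquivalence _).inverse (ObjectProperty.topEquivalence _).symm.toAdjunction
        ⊤ (ObjectProperty.topEquivalence _).inverse (ObjectProperty.topEquivalence _).symm.toAdjunction
        (TemperedFrobenioid.ofRankOneObjectConnectedPart P₀ hpf R S ↥T.PiCdot R' S').Φ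
        (TemperedFrobenioid.isPerfect_Φ_ofRankOneObjectConnectedPart P₀ hpf R S ↥T.PiCdot R' S')
        (TemperedFrobenioid.ofRankOneObjectConnectedPart P₀ hpf R S ↥T.PiCdot R' S').isGroupSaturated
        (TemperedFrobenioid.ofRankOneObjectConnectedPart P₀ hpf R S ↥T.PiCdot R' S').isPerfFactorial
        (TemperedFrobenioid.isNonDilating_pull_ofRankOneObjectConnectedPart P₀ hpf R S ↥T.PiCdot R' S')).thetaFrobenioid α
        (Example39Data.frobenioidHyp_ofInducedSquare_ofTempered T.dotXToDotC (MonoidHom.id _) (MonoidHom.id _) T.dotXToDotC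
          (isOpenMap_dotXToDotC T) IsOpenMap.id IsOpenMap.id (isOpenMap_dotXToDotC T)
          (continuous_dotXToDotC T) continuous_id continuous_id (continuous_dotXToDotC T)
          (countable_quotient_PiCdot T hT) (countable_quotient_dotX T hT) (countable_quotient_PiCdot T hT)
          (by rw [MonoidHom.id_comp, MonoidHom.comp_id])
          ⊤ (ObjectProperty.topEquivalence _).inverse (ObjectProperty.topEquivalence _).symm.toAdjunction
          ⊤ (ObjectProperty.topEquivalence _).inverse (ObjectProperty.topEquivalence _).symm.toAdjunction
          (TemperedFrobenioid.ofRankOneObjectConnectedPart P₀ hpf R S ↥T.PiCdot R' S')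
          (TemperedFrobenioid.isPerfect_Φ_ofRankOneObjectConnectedPart P₀ hpf R S ↥T.PiCdot R' S')
          (TemperedFrobenioid.isNonDilating_pull_ofRankOneObjectConnectedPart P₀ hpf R S ↥T.PiCdot R' S') α IsRationalα
          IsStrictlyRationalα)).category (Example39Data.Dα α))
    (P : ((Example39Data.ofInducedSquare T.dotXToDotC (MonoidHom.id _) (MonoidHom.id _) T.dotXToDotC
        (isOpenMap_dotXToDotC T) IsOpenMap.id IsOpenMap.id (isOpenMap_dotXToDotC T)
        (continuous_dotXToDotC T) continuous_id continuous_id (continuous_dotXToDotC T)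
        (countable_quotient_PiCdot T hT) (countable_quotient_dotX T hT) (countable_quotient_PiCdot T hT)
        (by rw [MonoidHom.id_comp, MonoidHom.comp_id]) treeMonoidVocabWeak.{0}
        ((RealifiedDivisorMonoids.ofRlfZWeak dm hpf).precomp
          (TemperedFrobenioid.ofRankOneObjectConnectedPart P₀ hpf R S ↥T.PiCdot R' S').base)
        ⊤ (ObjectProperty.topEquivalence _).inverse (ObjectProperty.topEquivalence _).symm.toAdjunction
        ⊤ (ObjectProperty.topEquivalence _).inverse (ObjectProperty.topEquivalence _).symm.toAdjunction
        (TemperedFrobenioid.ofRankOneObjectConnectedPart P₀ hpf R S ↥T.PiCdot R' S').Φ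
        (TemperedFrobenioid.isPerfect_Φ_ofRankOneObjectConnectedPart P₀ hpf R S ↥T.PiCdot R' S')
        (TemperedFrobenioid.ofRankOneObjectConnectedPart P₀ hpf R S ↥T.PiCdot R' S').isGroupSaturated
        (TemperedFrobenioid.ofRankOneObjectConnectedPart P₀ hpf R S ↥T.PiCdot R' S').isPerfFactorial
        (TemperedFrobenioid.isNonDilating_pull_ofRankOneObjectConnectedPart P₀ hpf R S ↥T.PiCdot R' S')).thetaFrobenioid α
        (Example39Data.frobenioidHyp_ofInducedSquare_ofTempered T.dotXToDotC (MonoidHom.id _) (MonoidHom.id _) T.dotXToDotC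
          (isOpenMap_dotXToDotC T) IsOpenMap.id IsOpenMap.id (isOpenMap_dotXToDotC T)
          (continuous_dotXToDotC T) continuous_id continuous_id (continuous_dotXToDotC T)
          (countable_quotient_PiCdot T hT) (countable_quotient_dotX T hT) (countable_quotient_PiCdot T hT)
          (by rw [MonoidHom.id_comp, MonoidHom.comp_id])
          ⊤ (ObjectProperty.topEquivalence _).inverse (ObjectProperty.topEquivalence _).symm.toAdjunction
          ⊤ (ObjectProperty.topEquivalence _).inverse (ObjectProperty.topEquivalence _).symm.toAdjunction
          (TemperedFrobenioid.ofRankOneObjectConnectedPart P₀ hpf R S ↥T.PiCdot R' S')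
          (TemperedFrobenioid.isPerfect_Φ_ofRankOneObjectConnectedPart P₀ hpf R S ↥T.PiCdot R' S')
          (TemperedFrobenioid.isNonDilating_pull_ofRankOneObjectConnectedPart P₀ hpf R S ↥T.PiCdot R' S') α IsRationalα
          IsStrictlyRationalα)).VocabParams)
    {IsBFT : MorphismProperty
      ((Example39Data.ofInducedSquare T.dotXToDotC (MonoidHom.id _) (MonoidHom.id _) T.dotXToDotC
        (isOpenMap_dotXToDotC T) IsOpenMap.id IsOpenMap.id (isOpenMap_dotXToDotC T)
        (continuous_dotXToDotC T) continuous_id continuous_id (continuous_dotXToDotC T)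
        (countable_quotient_PiCdot T hT) (countable_quotient_dotX T hT) (countable_quotient_PiCdot T hT)
        (by rw [MonoidHom.id_comp, MonoidHom.comp_id]) treeMonoidVocabWeak.{0}
        ((RealifiedDivisorMonoids.ofRlfZWeak dm hpf).precomp
          (TemperedFrobenioid.ofRankOneObjectConnectedPart P₀ hpf R S ↥T.PiCdot R' S').base)
        ⊤ (ObjectProperty.topEquivalence _).inverse (ObjectProperty.topEquivalence _).symm.toAdjunction
        ⊤ (ObjectProperty.topEquivalence _).inverse (ObjectProperty.topEquivalence _).symm.toAdjunction
        (TemperedFrobenioid.ofRankOneObjectConnectedPart P₀ hpf R S ↥T.PiCdot R' S').Φ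
        (TemperedFrobenioid.isPerfect_Φ_ofRankOneObjectConnectedPart P₀ hpf R S ↥T.PiCdot R' S')
        (TemperedFrobenioid.ofRankOneObjectConnectedPart P₀ hpf R S ↥T.PiCdot R' S').isGroupSaturated
        (TemperedFrobenioid.ofRankOneObjectConnectedPart P₀ hpf R S ↥T.PiCdot R' S').isPerfFactorial
        (TemperedFrobenioid.isNonDilating_pull_ofRankOneObjectConnectedPart P₀ hpf R S ↥T.PiCdot R' S')).thetaFrobenioid α
        (Example39Data.frobenioidHyp_ofInducedSquare_ofTempered T.dotXToDotC (MonoidHom.id _) (MonoidHom.id _) T.dotXToDotC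
          (isOpenMap_dotXToDotC T) IsOpenMap.id IsOpenMap.id (isOpenMap_dotXToDotC T)
          (continuous_dotXToDotC T) continuous_id continuous_id (continuous_dotXToDotC T)
          (countable_quotient_PiCdot T hT) (countable_quotient_dotX T hT) (countable_quotient_PiCdot T hT)
          (by rw [MonoidHom.id_comp, MonoidHom.comp_id])
          ⊤ (ObjectProperty.topEquivalence _).inverse (ObjectProperty.topEquivalence _).symm.toAdjunction
          ⊤ (ObjectProperty.topEquivalence _).inverse (ObjectProperty.topEquivalence _).symm.toAdjunction
          (TemperedFrobenioid.ofRankOneObjectConnectedPart P₀ hpf R S ↥T.PiCdot R' S')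
          (TemperedFrobenioid.isPerfect_Φ_ofRankOneObjectConnectedPart P₀ hpf R S ↥T.PiCdot R' S')
          (TemperedFrobenioid.isNonDilating_pull_ofRankOneObjectConnectedPart P₀ hpf R S ↥T.PiCdot R' S') α IsRationalα
          IsStrictlyRationalα)).category}
    (h𝔉 : 𝔉.toTemperedFrobenioidStub =
      ((Example39Data.ofInducedSquare T.dotXToDotC (MonoidHom.id _) (MonoidHom.id _) T.dotXToDotC
        (isOpenMap_dotXToDotC T) IsOpenMap.id IsOpenMap.id (isOpenMap_dotXToDotC T)
        (continuous_dotXToDotC T) continuous_id continuous_id (continuous_dotXToDotC T)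
        (countable_quotient_PiCdot T hT) (countable_quotient_dotX T hT) (countable_quotient_PiCdot T hT)
        (by rw [MonoidHom.id_comp, MonoidHom.comp_id]) treeMonoidVocabWeak.{0}
        ((RealifiedDivisorMonoids.ofRlfZWeak dm hpf).precomp
          (TemperedFrobenioid.ofRankOneObjectConnectedPart P₀ hpf R S ↥T.PiCdot R' S').base)
        ⊤ (ObjectProperty.topEquivalence _).inverse (ObjectProperty.topEquivalence _).symm.toAdjunction
        ⊤ (ObjectProperty.topEquivalence _).inverse (ObjectProperty.topEquivalence _).symm.toAdjunction
        (TemperedFrobenioid.ofRankOneObjectConnectedPart P₀ hpf R S ↥T.PiCdot R' S').Φ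
        (TemperedFrobenioid.isPerfect_Φ_ofRankOneObjectConnectedPart P₀ hpf R S ↥T.PiCdot R' S')
        (TemperedFrobenioid.ofRankOneObjectConnectedPart P₀ hpf R S ↥T.PiCdot R' S').isGroupSaturated
        (TemperedFrobenioid.ofRankOneObjectConnectedPart P₀ hpf R S ↥T.PiCdot R' S').isPerfFactorial
        (TemperedFrobenioid.isNonDilating_pull_ofRankOneObjectConnectedPart P₀ hpf R S ↥T.PiCdot R' S')).thetaFrobenioid α
        (Example39Data.frobenioidHyp_ofInducedSquare_ofTempered T.dotXToDotC (MonoidHom.id _) (MonoidHom.id _) T.dotXToDotC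
          (isOpenMap_dotXToDotC T) IsOpenMap.id IsOpenMap.id (isOpenMap_dotXToDotC T)
          (continuous_dotXToDotC T) continuous_id continuous_id (continuous_dotXToDotC T)
          (countable_quotient_PiCdot T hT) (countable_quotient_dotX T hT) (countable_quotient_PiCdot T hT)
          (by rw [MonoidHom.id_comp, MonoidHom.comp_id])
          ⊤ (ObjectProperty.topEquivalence _).inverse (ObjectProperty.topEquivalence _).symm.toAdjunction
          ⊤ (ObjectProperty.topEquivalence _).inverse (ObjectProperty.topEquivalence _).symm.toAdjunction
          (TemperedFrobenioid.ofRankOneObjectConnectedPart P₀ hpf R S ↥T.PiCdot R' S')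
          (TemperedFrobenioid.isPerfect_Φ_ofRankOneObjectConnectedPart P₀ hpf R S ↥T.PiCdot R' S')
          (TemperedFrobenioid.isNonDilating_pull_ofRankOneObjectConnectedPart P₀ hpf R S ↥T.PiCdot R' S') α IsRationalα
          IsStrictlyRationalα)).thetaStub
        (Example39Data.isIntegral_Φ_thetaFrobenioid_ofRlfZWeak hpf
          (TemperedFrobenioid.ofRankOneObjectConnectedPart P₀ hpf R S ↥T.PiCdot R' S').base _ α _) IsBFT)
    (Ψ : ((Example39Data.ofInducedSquare T.dotXToDotC (MonoidHom.id _) (MonoidHom.id _) T.dotXToDotC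
        (isOpenMap_dotXToDotC T) IsOpenMap.id IsOpenMap.id (isOpenMap_dotXToDotC T)
        (continuous_dotXToDotC T) continuous_id continuous_id (continuous_dotXToDotC T)
        (countable_quotient_PiCdot T hT) (countable_quotient_dotX T hT) (countable_quotient_PiCdot T hT)
        (by rw [MonoidHom.id_comp, MonoidHom.comp_id]) treeMonoidVocabWeak.{0}
        ((RealifiedDivisorMonoids.ofRlfZWeak dm hpf).precomp
          (TemperedFrobenioid.ofRankOneObjectConnectedPart P₀ hpf R S ↥T.PiCdot R' S').base)
        ⊤ (ObjectProperty.topEquivalence _).inverse (ObjectProperty.topEquivalence _).symm.toAdjunction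
        ⊤ (ObjectProperty.topEquivalence _).inverse (ObjectProperty.topEquivalence _).symm.toAdjunction
        (TemperedFrobenioid.ofRankOneObjectConnectedPart P₀ hpf R S ↥T.PiCdot R' S').Φ
        (TemperedFrobenioid.isPerfect_Φ_ofRankOneObjectConnectedPart P₀ hpf R S ↥T.PiCdot R' S')
        (TemperedFrobenioid.ofRankOneObjectConnectedPart P₀ hpf R S ↥T.PiCdot R' S').isGroupSaturated
        (TemperedFrobenioid.ofRankOneObjectConnectedPart P₀ hpf R S ↥T.PiCdot R' S').isPerfFactorial
        (TemperedFrobenioid.isNonDilating_pull_ofRankOneObjectConnectedPart P₀ hpf R S ↥T.PiCdot R' S')).thetaFrobenioid α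
        (Example39Data.frobenioidHyp_ofInducedSquare_ofTempered T.dotXToDotC (MonoidHom.id _) (MonoidHom.id _) T.dotXToDotC
          (isOpenMap_dotXToDotC T) IsOpenMap.id IsOpenMap.id (isOpenMap_dotXToDotC T)
          (continuous_dotXToDotC T) continuous_id continuous_id (continuous_dotXToDotC T)
          (countable_quotient_PiCdot T hT) (countable_quotient_dotX T hT) (countable_quotient_PiCdot T hT)
          (by rw [MonoidHom.id_comp, MonoidHom.comp_id])
          ⊤ (ObjectProperty.topEquivalence _).inverse (ObjectProperty.topEquivalence _).symm.toAdjunction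
          ⊤ (ObjectProperty.topEquivalence _).inverse (ObjectProperty.topEquivalence _).symm.toAdjunction
          (TemperedFrobenioid.ofRankOneObjectConnectedPart P₀ hpf R S ↥T.PiCdot R' S')
          (TemperedFrobenioid.isPerfect_Φ_ofRankOneObjectConnectedPart P₀ hpf R S ↥T.PiCdot R' S')
          (TemperedFrobenioid.isNonDilating_pull_ofRankOneObjectConnectedPart P₀ hpf R S ↥T.PiCdot R' S') α IsRationalα
          IsStrictlyRationalα)).category ≌
      ((Example39Data.ofInducedSquare T.dotXToDotC (MonoidHom.id _) (MonoidHom.id _) T.dotXToDotC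
        (isOpenMap_dotXToDotC T) IsOpenMap.id IsOpenMap.id (isOpenMap_dotXToDotC T)
        (continuous_dotXToDotC T) continuous_id continuous_id (continuous_dotXToDotC T)
        (countable_quotient_PiCdot T hT) (countable_quotient_dotX T hT) (countable_quotient_PiCdot T hT)
        (by rw [MonoidHom.id_comp, MonoidHom.comp_id]) treeMonoidVocabWeak.{0}
        ((RealifiedDivisorMonoids.ofRlfZWeak dm hpf).precomp
          (TemperedFrobenioid.ofRankOneObjectConnectedPart P₀ hpf R S ↥T.PiCdot R' S').base)
        ⊤ (ObjectProperty.topEquivalence _).inverse (ObjectProperty.topEquivalence _).symm.toAdjunction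
        ⊤ (ObjectProperty.topEquivalence _).inverse (ObjectProperty.topEquivalence _).symm.toAdjunction
        (TemperedFrobenioid.ofRankOneObjectConnectedPart P₀ hpf R S ↥T.PiCdot R' S').Φ
        (TemperedFrobenioid.isPerfect_Φ_ofRankOneObjectConnectedPart P₀ hpf R S ↥T.PiCdot R' S')
        (TemperedFrobenioid.ofRankOneObjectConnectedPart P₀ hpf R S ↥T.PiCdot R' S').isGroupSaturated
        (TemperedFrobenioid.ofRankOneObjectConnectedPart P₀ hpf R S ↥T.PiCdot R' S').isPerfFactorial
        (TemperedFrobenioid.isNonDilating_pull_ofRankOneObjectConnectedPart P₀ hpf R S ↥T.PiCdot R' S')).thetaFrobenioid α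
        (Example39Data.frobenioidHyp_ofInducedSquare_ofTempered T.dotXToDotC (MonoidHom.id _) (MonoidHom.id _) T.dotXToDotC
          (isOpenMap_dotXToDotC T) IsOpenMap.id IsOpenMap.id (isOpenMap_dotXToDotC T)
          (continuous_dotXToDotC T) continuous_id continuous_id (continuous_dotXToDotC T)
          (countable_quotient_PiCdot T hT) (countable_quotient_dotX T hT) (countable_quotient_PiCdot T hT)
          (by rw [MonoidHom.id_comp, MonoidHom.comp_id])
          ⊤ (ObjectProperty.topEquivalence _).inverse (ObjectProperty.topEquivalence _).symm.toAdjunction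
          ⊤ (ObjectProperty.topEquivalence _).inverse (ObjectProperty.topEquivalence _).symm.toAdjunction
          (TemperedFrobenioid.ofRankOneObjectConnectedPart P₀ hpf R S ↥T.PiCdot R' S')
          (TemperedFrobenioid.isPerfect_Φ_ofRankOneObjectConnectedPart P₀ hpf R S ↥T.PiCdot R' S')
          (TemperedFrobenioid.isNonDilating_pull_ofRankOneObjectConnectedPart P₀ hpf R S ↥T.PiCdot R' S') α IsRationalα
          IsStrictlyRationalα)).category)
    (hrs : P.IsRationallyStandard) (h38 : P.HypothesesCor38 Ψ) (h44 : P.HypothesesThm44 Ψ) :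
    FrobenioidThetaBiKummer.ApplicabilityOfGeneralTheory 𝔉 (TemperedFrobenioid.thetaVocab 𝔉 P) Ψ :=
  Example39Data.applicability_of_example39 _ α _ 𝔉 P h𝔉 Ψ hrs
    (isSlim_connectedPart_bTemp (hT.subgroup_of_isClosed T.PiCdot (T.PiCdot.isClosed_of_isOpen T.isOpen_PiCdot)) hZs) rfl
    (Example39Data.isNonDilating_pull_divisorMonoid_thetaFrobenioid_weak _ α _)
    (example39_iv_cuspidallyPure_dotC_ofRankOneObject T hT P₀ hpf R S R' S' α IsRationalα IsStrictlyRationalα) h38 h44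

end ThetaCovers.TemperedCoverData

end Literature.AnabelianGeometry.EtaleTheta

end
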